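import Literature.ModelTheory.ExponentialFields.DefinableBaire
import Mathlib.Topology.Homeomorph.Lemmas
import HarnessLib

/-!
# Definably meager sets and definably Baire subsets (Fornasiero–Servi 2010, §2)

Topic `Literature/ModelTheory/ExponentialFields`.  A. Fornasiero – T. Servi, *Definably complete
Baire structures*, Fund. Math. 209 (2010), §2, Def. 2.1: for `X ⊆ Y ⊆ Kⁿ` (`Y` definable),
"`X` is nowhere dense (in `Y`) if `int_Y(cl_Y(X)) = ∅`.  `X` is definably meager (in `Y`) if
there exists a definable increasing family `(A(t))_{t ∈ K}` of nowhere dense subsets of `Y`,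
such that `X ⊆ ⋃_t A(t)`"; Def. 2.2: "`Y` is definably Baire if every non-empty open definable
subset of `Y` is not definably meager (in `Y`)"; "the definably meager subsets of `Y` form an
ideal".  This file vendors these notions for subsets of `Mⁿ` (families indexed by `M`, given —
as in `DefinableFamilyClosure.lean` — by the definable set `{(t, x) | x ∈ A t} ⊆ Mⁿ⁺¹`) and
relates the case `Y = X = M` to the notion `IsDefinablyBaire` of `DefinableBaire.lean`
(Def. 2.9: a structure is Baire iff the line is definably Baire as a subset of itself):

* `IsNowhereDenseIn Y X`, `isNowhereDenseIn_univ_iff` (`= IsNowhereDense`), `.mono`, `.union`;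
* `IsDefinablyMeagerIn L Y X` and the ideal properties `.mono`, `.union`;
* `IsDefinablyBaireIn L Y`;
* `isNowhereDense_setOf_apply_mem_iff` (the line `M` versus `1`-tuples);
* **`isDefinablyBaire_iff_not_isDefinablyMeagerIn_univ`**: `L.IsDefinablyBaire M` iff the line
  (as `1`-tuples) is not definably meager in itself; `IsDefinablyBaireIn.isDefinablyBaire`.

Everything is proved; the definitions are the three notions.  No named facts.

## References

* A. Fornasiero, T. Servi, *Definably complete Baire structures*, Fund. Math. 209 (2010),
  Def. 2.1, Def. 2.2, Def. 2.9. [FornasieroServi2010]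
-/

universe u v w

open Set FirstOrder FirstOrder.Language
open _root_.Filter _root_.Topology

namespace Literature.ModelTheory.ExponentialFields

variable {L : FirstOrder.Language.{u, v}} {M : Type w} [L.Structure M] {n : ℕ}

/-! ### Nowhere dense subsets relative to `Y` -/

section NowhereDense

variable {α : Type*} [TopologicalSpace α]

/-- **`X` is nowhere dense in `Y`** (Fornasiero–Servi 2010, Def. 2.1: `int_Y(cl_Y(X)) = ∅`): no
non-empty relatively open subset of `Y` lies in the closure of `X`.  A definition.
[cite: FornasieroServi2010, Def. 2.1] -/
def IsNowhereDenseIn (Y X : Set α) : Prop :=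
  ∀ U : Set α, IsOpen U → U ∩ Y ⊆ closure X → U ∩ Y = ∅

/-- Unfolding lemma. [cite: FornasieroServi2010, Def. 2.1] -/
theorem isNowhereDenseIn_iff {Y X : Set α} : IsNowhereDenseIn Y X ↔
    ∀ U : Set α, IsOpen U → U ∩ Y ⊆ closure X → U ∩ Y = ∅ := Iff.rfl

/-- Relative to the whole space, `IsNowhereDenseIn` is Mathlib's `IsNowhereDense`
(`interior (closure X) = ∅`). [folklore] -/
theorem isNowhereDenseIn_univ_iff {X : Set α} : IsNowhereDenseIn univ X ↔ IsNowhereDense X := by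
  rw [IsNowhereDense]
  constructor
  · intro h
    have h1 := h (interior (closure X)) isOpen_interior (by simpa using interior_subset)
    simpa using h1
  · intro h U hU hsub
    rw [inter_univ] at hsub ⊢
    have h1 : U ⊆ interior (closure X) := interior_maximal hsub hU
    rw [h] at h1
    exact subset_empty_iff.1 h1

/-- A subset of a nowhere dense set is nowhere dense. [folklore] -/
theorem IsNowhereDenseIn.mono {Y X X' : Set α} (h : IsNowhereDenseIn Y X) (hX : X' ⊆ X) :
    IsNowhereDenseIn Y X' := fun U hU hsub =>
  h U hU (hsub.trans (closure_mono hX))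

/-- Nowhere dense subsets of `Y` are closed under binary unions. [cite: FornasieroServi2010, §2] -/
theorem IsNowhereDenseIn.union {Y X₁ X₂ : Set α} (h₁ : IsNowhereDenseIn Y X₁)
    (h₂ : IsNowhereDenseIn Y X₂) : IsNowhereDenseIn Y (X₁ ∪ X₂) := by
  intro U hU hsub
  rw [closure_union] at hsub
  -- the open set `U \\ closure X₁` meets `Y` inside `closure X₂`, hence not at all
  have h3 : (U \ closure X₁) ∩ Y = ∅ := by
    refine h₂ _ (hU.sdiff isClosed_closure) fun x hx => ?_
    rcases hsub ⟨hx.1.1, hx.2⟩ with h | h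
    · exact absurd h hx.1.2
    · exact h
  -- so `U ∩ Y ⊆ closure X₁`, hence `U ∩ Y = ∅`
  refine h₁ U hU fun x hx => ?_
  by_contra hx1
  have : x ∈ (U \ closure X₁) ∩ Y := ⟨⟨hx.1, hx1⟩, hx.2⟩
  rw [h3] at this
  exact this

/-- The empty set is nowhere dense in any `Y`. [folklore] -/
theorem isNowhereDenseIn_empty (Y : Set α) : IsNowhereDenseIn Y (∅ : Set α) := by
  intro U _ hsub
  rw [closure_empty, subset_empty_iff] at hsub
  exact hsub

end NowhereDense

/-! ### Definably meager subsets and definably Baire subsets of `Mⁿ` -/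

section Meager

variable [TopologicalSpace M] [LE M]

variable (L) in
/-- **`X` is definably meager in `Y`** (`X, Y ⊆ Mⁿ`; Fornasiero–Servi 2010, Def. 2.1): there is
an increasing family `(A t)_{t ∈ M}` of nowhere dense subsets of `Y`, definable as the set
`{(t, x) | x ∈ A t} ⊆ Mⁿ⁺¹` (with parameters), with `X ⊆ ⋃_t A t`.  A definition.
[cite: FornasieroServi2010, Def. 2.1] -/
def IsDefinablyMeagerIn (Y X : Set (Fin n → M)) : Prop :=
  ∃ A : M → Set (Fin n → M),
    (univ : Set M).Definable L {v : Fin (n + 1) → M | Fin.tail v ∈ A (v 0)} ∧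
      (∀ t, IsNowhereDenseIn Y (A t)) ∧ (∀ s t, s ≤ t → A s ⊆ A t) ∧ X ⊆ ⋃ t, A t

variable (L) in
/-- **`Y ⊆ Mⁿ` is definably Baire** (Fornasiero–Servi 2010, Def. 2.2): every non-empty open
definable subset of `Y` (the trace `U ∩ Y` of an open definable `U`) is not definably meager in
`Y`.  A definition. [cite: FornasieroServi2010, Def. 2.2] -/
def IsDefinablyBaireIn (Y : Set (Fin n → M)) : Prop :=
  ∀ U : Set (Fin n → M), (univ : Set M).Definable L U → IsOpen U → (U ∩ Y).Nonempty →
    ¬ IsDefinablyMeagerIn L Y (U ∩ Y)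

/-- A subset of a definably meager set is definably meager. [cite: FornasieroServi2010, §2] -/
theorem IsDefinablyMeagerIn.mono {Y X X' : Set (Fin n → M)} (h : IsDefinablyMeagerIn L Y X)
    (hX : X' ⊆ X) : IsDefinablyMeagerIn L Y X' := by
  obtain ⟨A, hA, hnd, hinc, hcov⟩ := h
  exact ⟨A, hA, hnd, hinc, hX.trans hcov⟩

/-- **The definably meager subsets of `Y` form an ideal**: binary unions (the union of the two
witnessing families). [cite: FornasieroServi2010, §2] -/
theorem IsDefinablyMeagerIn.union {Y X₁ X₂ : Set (Fin n → M)} (h₁ : IsDefinablyMeagerIn L Y X₁)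
    (h₂ : IsDefinablyMeagerIn L Y X₂) : IsDefinablyMeagerIn L Y (X₁ ∪ X₂) := by
  obtain ⟨A, hA, hndA, hincA, hcovA⟩ := h₁
  obtain ⟨B, hB, hndB, hincB, hcovB⟩ := h₂
  refine ⟨fun t => A t ∪ B t, ?_, fun t => (hndA t).union (hndB t),
    fun s t hst => union_subset_union (hincA s t hst) (hincB s t hst), ?_⟩
  · have h := hA.union hB
    refine (congrArg _ ?_).mpr h
    ext v
    simp
  · rintro x (hx | hx)
    · obtain ⟨t, ht⟩ := mem_iUnion.1 (hcovA hx)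
      exact mem_iUnion.2 ⟨t, Or.inl ht⟩
    · obtain ⟨t, ht⟩ := mem_iUnion.1 (hcovB hx)
      exact mem_iUnion.2 ⟨t, Or.inr ht⟩

/-- The empty set is definably meager (the constant empty family). [folklore] -/
theorem isDefinablyMeagerIn_empty (Y : Set (Fin n → M)) : IsDefinablyMeagerIn L Y (∅ : Set (Fin n → M)) := by
  refine ⟨fun _ => ∅, ?_, fun _ => isNowhereDenseIn_empty Y, fun _ _ _ => le_rfl, empty_subset _⟩
  have h : {v : Fin (n + 1) → M | Fin.tail v ∈ (fun _ : M => (∅ : Set (Fin n → M))) (v 0)} = ∅ := by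
    ext v; simp
  rw [h]
  exact definable_empty

end Meager

/-! ### The line versus `1`-tuples -/

section Line

variable [TopologicalSpace M]

omit [L.Structure M] in
/-- A subset of the line is nowhere dense iff the corresponding set of `1`-tuples is (the
homeomorphism `Homeomorph.funUnique`). [folklore] -/
theorem isNowhereDense_setOf_apply_mem_iff {S : Set M} :
    IsNowhereDense {x : Fin 1 → M | x 0 ∈ S} ↔ IsNowhereDense S := by
  have e := Homeomorph.funUnique (Fin 1) M
  have h1 : (Homeomorph.funUnique (Fin 1) M) '' {x : Fin 1 → M | x 0 ∈ S} = S := by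
    ext y
    simp only [mem_image, mem_setOf_eq, Homeomorph.funUnique]
    constructor
    · rintro ⟨x, hx, rfl⟩; exact hx
    · intro hy; exact ⟨fun _ => y, hy, rfl⟩
  have h2 : (Homeomorph.funUnique (Fin 1) M).symm '' S = {x : Fin 1 → M | x 0 ∈ S} := by
    ext x
    simp only [mem_image, mem_setOf_eq]
    constructor
    · rintro ⟨y, hy, rfl⟩; simpa [Homeomorph.funUnique] using hy
    · intro hx
      refine ⟨x 0, hx, ?_⟩
      funext i
      simp [Homeomorph.funUnique, Subsingleton.elim i 0]
  constructor
  · intro h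
    rw [← h1]
    exact (Homeomorph.funUnique (Fin 1) M).isInducing.isNowhereDense_image h
  · intro h
    rw [← h2]
    exact (Homeomorph.funUnique (Fin 1) M).symm.isInducing.isNowhereDense_image h

variable [LE M]

/-- **`IsDefinablyBaire` is "the line is not definably meager in itself"** (Fornasiero–Servi
2010, Def. 2.9 with Def. 2.1–2.2, the instance `U = Y = K`; Hieronymi 2013, Theorem A).
[cite: FornasieroServi2010, Def. 2.9] -/
theorem isDefinablyBaire_iff_not_isDefinablyMeagerIn_univ :
    L.IsDefinablyBaire M ↔ ¬ IsDefinablyMeagerIn L (univ : Set (Fin 1 → M)) univ := by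
  constructor
  · rintro hB ⟨A, hA, hnd, hinc, hcov⟩
    -- the family as a subset of `M²`
    have hY : (univ : Set M).Definable L {w : Fin 2 → M | (![w 1] : Fin 1 → M) ∈ A (w 0)} := by
      refine (congrArg _ ?_).mpr hA
      ext w
      simp only [mem_setOf_eq]
      refine Iff.of_eq (congrArg (· ∈ A (w 0)) ?_)
      funext i
      simp [Fin.tail, Subsingleton.elim i 0]
    have hnd' : ∀ t, IsNowhereDense
        {x : M | (![t, x] : Fin 2 → M) ∈ {w : Fin 2 → M | (![w 1] : Fin 1 → M) ∈ A (w 0)}} := by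
      intro t
      have h1 : {x : M | (![t, x] : Fin 2 → M) ∈ {w : Fin 2 → M | (![w 1] : Fin 1 → M) ∈ A (w 0)}} =
          {x : M | x ∈ {y : M | (![y] : Fin 1 → M) ∈ A t}} := by
        ext x; simp
      rw [h1]
      have h2 := hnd t
      rw [isNowhereDenseIn_univ_iff] at h2
      rw [← isNowhereDense_setOf_apply_mem_iff]
      refine h2.mono ?_
      intro y hy
      have : y = ![y 0] := by funext i; simp [Subsingleton.elim i 0]
      rw [this]
      exact hy
    have hinc' : ∀ s t, s ≤ t →
        {x : M | (![s, x] : Fin 2 → M) ∈ {w : Fin 2 → M | (![w 1] : Fin 1 → M) ∈ A (w 0)}} ⊆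
          {x : M | (![t, x] : Fin 2 → M) ∈ {w : Fin 2 → M | (![w 1] : Fin 1 → M) ∈ A (w 0)}} := by
      intro s t hst x hx
      simp only [mem_setOf_eq, Matrix.cons_val_zero, Matrix.cons_val_one] at hx ⊢
      exact hinc s t hst hx
    obtain ⟨x, hx⟩ := hB _ hY hnd' hinc'
    obtain ⟨t, ht⟩ := mem_iUnion.1 (hcov (mem_univ (![x] : Fin 1 → M)))
    exact hx t (by simpa using ht)
  · intro h Y hY hnd hinc
    by_contra hcov
    push Not at hcov
    refine h ⟨fun t => {x : Fin 1 → M | (![t, x 0] : Fin 2 → M) ∈ Y}, ?_, fun t => ?_,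
      fun s t hst x hx => hinc s t hst hx, fun x _ => ?_⟩
    · refine (congrArg _ ?_).mpr hY
      ext v
      simp only [mem_setOf_eq, Fin.tail]
      refine Iff.of_eq (congrArg (· ∈ Y) ?_)
      funext i
      fin_cases i <;> rfl
    · rw [isNowhereDenseIn_univ_iff]
      exact (isNowhereDense_setOf_apply_mem_iff (S := {x : M | (![t, x] : Fin 2 → M) ∈ Y})).2
        (hnd t)
    · obtain ⟨t, ht⟩ := hcov (x 0)
      exact mem_iUnion.2 ⟨t, ht⟩

/-- **A structure whose line is definably Baire as a subset of itself is definably Baire**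
(Fornasiero–Servi 2010, Def. 2.9: "`K` is a Baire structure if `K` is definably Baire as a
definable subset of `K` itself"; the instance `U = K` of Def. 2.2). [cite: FornasieroServi2010, Def. 2.9] -/
theorem IsDefinablyBaireIn.isDefinablyBaire [Nonempty M]
    (h : IsDefinablyBaireIn L (univ : Set (Fin 1 → M))) : L.IsDefinablyBaire M := by
  rw [isDefinablyBaire_iff_not_isDefinablyMeagerIn_univ]
  have h1 := h univ definable_univ isOpen_univ (by simp)
  simpa using h1

end Line

end Literature.ModelTheory.ExponentialFields
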